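import Literature.AlgebraicGeometry.HodgeTheory.ComplexTorusIntegralHodgeClassesKunnethProjectorsTraces
import Literature.AlgebraicGeometry.HodgeTheory.ComplexTorusIntegralHodgeClassesKunnethProjectorsMultiplication
import Literature.AlgebraicGeometry.HodgeTheory.ComplexTorusIntegralHodgeClassesKunnethProjectorsDegree
import HarnessLib

/-!
# The Künneth projectors read the characteristic polynomial: `deg((π_a ∘ [Γ_f]) · [Δ_X]) = coeff_{tᵃ} P^r_f(t)`

Sequel of g29-#9 (`ComplexTorusIntegralHodgeClassesKunnethProjectorsTraces`: Fulton's Example 16.1.15 graded, `deg((π_a ∘ α) · [Δ_X]) = (−1)ᵈ Tr(α^* | Hᵈ(X, ℂ))`,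
`a + d = 2g`) at the graph `α = [Γ_f]` of an endomorphism `f` of a complex torus `X` of dimension `g`. Fulton: "If `α` corresponds to a morphism `f : X → X`, one
recovers a fixed point theorem for `f`" (p0302 L42), `(Γ_f)^* = f^*` (Prop. 16.1.2 (c), p0295 L30; Lange Prop. 6.2.9 (b) "`ᵗΓ_f(β) = f^*(β)`", p0304 L22; Layer A
`corrMapT_cycleForm_graph`, ON THE NOSE on invariant forms); and by A1-33 (`ComplexTorusLefschetzNumber`) the graded traces of `f^*` are the coefficients of the
characteristic polynomial `P^r_f(t) = det(t·1_Λ − ρ_r(f)) = Σ_ν (−1)^ν r_ν t^{2g−ν}` of the rational representation (Lange §2.4.1, p0114 L8–L12, L37;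
`r_ν = Tr(f^*|H^ν(X, ℚ))`, A1-33 `trace_pullbackForms_eq_charpoly_coeff`). Hence, on the INTEGRAL carriers `Hdg•(−, ℤ)` of the lane (g27 conventions):

* §1 **`cast_integralHodgeClassesDeg_corrComp_graphClass_kunnethProjector_cup_diagonalClass_eq_trace`** — `deg((π_a ∘ [Γ_f]) · [Δ_X]) = (−1)ᵈ Tr(f^* | Hᵈ(X, ℂ))`
  (`f^*|Hᵈ(X, ℂ) = pullbackAlt (ρ_r(f)) d`, skel-4's `ℂ`-linear pull-back of invariant forms) and **`…_eq_ratCast_trace_pullbackForms`** — `= (−1)ᵈ Tr(f^* | Hᵈ(X, ℚ))`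
  (A1-33's `pullbackForms` on `rationalForms`, Layer A `trace_pullbackAlt_realRep_eq_ratCast_trace_pullbackForms`);
* §2 **`integralHodgeClassesDeg_corrComp_graphClass_kunnethProjector_cup_diagonalClass_eq_charpoly_coeff`** — **`deg((π_a ∘ [Γ_f]) · [Δ_X]) = coeff_{tᵃ} P^r_f(t)`** in `ℤ`,
  for EVERY `a` (both sides vanish for `a > 2g`): the `2g + 1` intersection numbers of the integral classes `π_a ∘ [Γ_f]` with the diagonal ARE the coefficients of the
  characteristic polynomial of `ρ_r(f)`; equivalently `= (−1)ᵈ · Σ_{|I| = d} det ρ_r(f)_{I,I}` (sum of the principal `d`-minors, `…_eq_sum_minors`);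
* §3 **`sum_range_integralHodgeClassesDeg_corrComp_graphClass_kunnethProjector_cup_diagonalClass`** — summing over `a` gives back the Lefschetz fixed-point formula
  `deg([Γ_f] · [Δ_X]) = Σ_a coeff_{tᵃ} P^r_f = P^r_f(1) = det(1 − ρ_r(f))` (`Σ_a π_a ∘ [Γ_f] = [Γ_f]`, g29-#8; a second proof of g28's
  `integralHodgeClassesDeg_diagonalClass_cup_graphClass_eq_det`, here without a `LinearOrder` on the lattice index);
* §4 **`integralHodgeClassesDeg_corrComp_graphClass_intMul_kunnethProjector_cup_diagonalClass`** — at `f = n_X`: `deg((π_a ∘ [Γ_{n_X}]) · [Δ_X]) = n^d · (−1)ᵈ C(2g, d)`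
  (`π_a ∘ Γ_{n_X} = n^{2g−a} π_a`, (6.19) transposed, g29-#10; `deg(π_a · [Δ]) = (−1)ᵈ C(2g, d)`, g29-#12) — the coefficients of `P^r_{n_X}(t) = (t − n)^{2g}`.

Everything is a theorem; no definition, no named fact (D-0026). Frames: `eX`, `e` as in g29-#5 (`hX`, `hg₁`, `hc`, `hg'` the rank bookkeeping of `Δ_*`), the composite
`π_a ∘ α = p₁₃*(p₁₂^*α · p₂₃^*π_a)` formed on `X × (X × X)` in any frame `eT` (g27-#5 convention).

## References
* [Fulton1998] W. Fulton, Intersection Theory, 2nd ed., Springer 1998, §16.1 Prop. 16.1.2 (c) (p0295 L30), Example 16.1.15 (p0302 L27–L42).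
* [Lange2023AbelianVarietiesComplex] H. Lange, Abelian Varieties over the Complex Numbers, Springer 2023, §2.4.1 Prop. 2.4.3 and the expansion
  `P^r_f(t) = Σ (−1)^ν r_ν t^{2g−ν}` (p0114 L8–L37), §6.2.2 Prop. 6.2.9 (b) (p0304 L22), §6.3.4 Prop. 6.3.11 (p0319 L9–L12).
* [FarmakisMoskowitz2013] I. Farmakis, M. Moskowitz, Fixed Point Theorems and Their Applications, World Scientific 2013, Lemma 3.5.17 (PDF p. 85), §5.6 (PDF p. 135).
-/

noncomputable section

open CategoryTheory Function

namespace Literature.AlgebraicGeometry.HodgeTheory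

open Literature.AlgebraicGeometry.Motives Literature.AlgebraicGeometry.Motives.HodgeStructure
open Literature.Geometry.Kaehler Literature.Geometry.Kaehler.ComplexTorus

/-! ### §0 A cast (forms) -/

section TorusForms

variable {ι₁ ι₂ : Type*} [Fintype ι₁] [Fintype ι₂] [DecidableEq ι₁] [DecidableEq ι₂] {E₁ E₂ : Type*} [NormedAddCommGroup E₁] [NormedSpace ℂ E₁]
  [NormedAddCommGroup E₂] [NormedSpace ℂ E₂] (Φ₁ : (ι₁ → ℝ) ≃L[ℝ] E₁) (Φ₂ : (ι₂ → ℝ) ≃L[ℝ] E₂)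

/-- `γ^*` of a re-indexed form is `γ^*` in the other presentation (it depends on neither enumeration, Layer A `corrMapT_eq_of_enum`). [cite: VoisinHodgeI2002, §11.3.3 Lemma 11.41] -/
private theorem corrMapT_domDomCongr_finCongr₉ {a b d m m' : ℕ} (h : m = m') (e₁ : Fin (a + d) ≃ ι₁) (e : Fin ((a + b) + m) ≃ ι₁ ⊕ ι₂)
    (e' : Fin ((a + b) + m') ≃ ι₁ ⊕ ι₂) (γ : (E₁ × E₂) [⋀^Fin m]→L[ℝ] ℂ) :
    corrMapT Φ₁ Φ₂ e₁ e' (γ.domDomCongr (finCongr h)) = corrMapT Φ₁ Φ₂ e₁ e γ := by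
  subst h
  rw [domDomCongr_finCongr_self]
  exact corrMapT_eq_of_enum Φ₁ Φ₂ e₁ e' e γ

end TorusForms

namespace ComplexTorusCat

/-- The lattice rank of `X` read off a frame. [cite: Lange2023AbelianVarietiesComplex, §1.1.2 (p0019 L1–L4)] -/
private theorem fintypeCard_eq_of_frame₉ (X : ComplexTorusCat) {N : ℕ} (ε : Fin N ≃ X.toIsog.ι) : Fintype.card X.toIsog.ι = N := by
  rw [← Fintype.card_congr ε, Fintype.card_fin]

section Graph

variable (X : ComplexTorusCat) {g₁ g : ℕ} (hgg : g₁ + g₁ = g) (eX : Fin (2 * g₁) ≃ X.toIsog.ι) (e : Fin (2 * g) ≃ (prodObj X X).toIsog.ι)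
  (hX : 2 * g₁ + 2 * 0 = 2 * g₁) (hg₁ : g₁ + g₁ = 2 * g₁) (hc : 2 * g₁ + 2 * g₁ = 2 * g) (hg' : g + g = 2 * g)
  {nT gT l₃ : ℕ} (eT : Fin nT ≃ (prodObj X (prodObj X X)).toIsog.ι) (h3 : l₃ + 2 * g = nT) (hgT : gT + gT = nT) (h3' : l₃ + 2 * g₁ = 2 * g) (f : X ⟶ X)

/-! ### §1 `deg((π_a ∘ [Γ_f]) · [Δ_X]) = (−1)ᵈ Tr(f^* | Hᵈ(X))`, `a + d = 2g` -/

/-- **`deg_{X×X}((π_a ∘ [Γ_f]) · [Δ_X]) = (−1)ᵈ Tr(f^* : Hᵈ(X, ℂ) → Hᵈ(X, ℂ))`** for an endomorphism `f` of a complex torus `X` of dimension `g` and `a + d = 2g` — Fulton's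
graded Lefschetz formula `deg((π_a ∘ α) · [Δ]) = (−1)ᵈ Tr(α^*|Hᵈ)` (g29-#9) at `α = [Γ_f] = (1, f)_*1_X`, whose action is `(Γ_f)^* = f^*` (Prop. 16.1.2 (c); Lange Prop. 6.2.9 (b)
`ᵗΓ_f(β) = f^*β`; Layer A `corrMapT_cycleForm_graph`: `[Γ_f]^*β = β ∘ ρ_r(f)`), `f^*|Hᵈ(X, ℂ) = pullbackAlt ρ_r(f) d` on `Hᵈ(X, ℂ) = Altᵈ_ℝ(E; ℂ)`.
[cite: Fulton1998, §16.1 Example 16.1.15 (p0302 L36–L42) and Prop. 16.1.2 (c) (p0295 L30)] [cite: Lange2023AbelianVarietiesComplex, §6.2.2 Prop. 6.2.9 (b) (p0304 L22)] -/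
theorem cast_integralHodgeClassesDeg_corrComp_graphClass_kunnethProjector_cup_diagonalClass_eq_trace {a d : ℕ} (had : 2 * g₁ = d + a) :
    ((integralHodgeClassesDeg (prodObj X X) e
        (integralHodgeClassesCup (prodObj X X).toIsog.Φ hgg
          (integralHodgeClassesPushforward g g₁ (liftHom (fstHom X (prodObj X X)) (sndHom X (prodObj X X) ≫ sndHom X X)) eT e h3 hgT h3' hg'
            (integralHodgeClassesCup (prodObj X (prodObj X X)).toIsog.Φ hgg
              (integralHodgeClassesPullbackHom (liftHom (fstHom X (prodObj X X)) (sndHom X (prodObj X X) ≫ fstHom X X)) g₁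
                (integralHodgeClassesPushforward 0 g₁ (graphHom f) eX e hX hg₁ hc hg' (unitIntegralHodgeClass X)))
              (integralHodgeClassesPullbackHom (sndHom X (prodObj X X)) g₁ (kunnethProjector X eX e hX hg₁ hc hg' a))))
          (integralHodgeClassesPushforward 0 g₁ (diagHom X) eX e hX hg₁ hc hg' (unitIntegralHodgeClass X))) : ℤ) : ℂ) =
      (-1 : ℂ) ^ d * LinearMap.trace ℂ (X.toIsog.E [⋀^Fin d]→L[ℝ] ℂ) (pullbackAlt (realRep X.toIsog.Φ X.toIsog.Φ f.1) d) := by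
  obtain ⟨L, hL⟩ := exists_analyticRep f
  obtain ⟨eX', heX'⟩ := exists_orientationSign_eq_one X.toIsog.Φ eX
  obtain ⟨ε₁, hε₁⟩ := exists_orientationSign_eq_one X.toIsog.Φ ((finCongr (by omega : a + d = 2 * g₁)).trans eX)
  set ε : Fin ((a + d) + (d + a)) ≃ X.toIsog.ι ⊕ X.toIsog.ι := (finCongr (by omega : (a + d) + (d + a) = 2 * g)).trans e with hε
  set G : Fin ((a + d) + 2 * g₁) ≃ X.toIsog.ι ⊕ X.toIsog.ι := (finCongr (by omega : (a + d) + 2 * g₁ = 2 * g)).trans e with hG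
  rw [cast_integralHodgeClassesDeg_corrComp_kunnethProjector_cup_diagonalClass_eq_trace X hgg eX e hX hg₁ hc hg' eT h3 hgT h3' had ε₁ ε,
    integralHodgeClassesPushforward_eq_of_enum 0 g₁ (graphHom f) eX eX' e e hX hg₁ hc hg',
    coe_integralHodgeClassesPushforward_graphHom_unitIntegralHodgeClass f eX' e hX hg₁ hc hg' heX' L hL ((finCongr hc).trans e)]
  congr 2
  refine LinearMap.ext fun β ↦ ?_
  rw [corrMapT_domDomCongr_finCongr₉ X.toIsog.Φ X.toIsog.Φ had ε₁ G ε,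
    SubtorusFrame.cycleForm_graph_eq_of_enum X.toIsog.Φ X.toIsog.Φ eX' heX' ε₁ hε₁ hL _ G, corrMapT_cycleForm_graph X.toIsog.Φ X.toIsog.Φ ε₁ hε₁ hL G β,
    pullbackAlt_apply]

/-- **`deg_{X×X}((π_a ∘ [Γ_f]) · [Δ_X]) = (−1)ᵈ Tr(f^* : Hᵈ(X, ℚ) → Hᵈ(X, ℚ))`** (`a + d = 2g`) with A1-33's rational pull-back `f^* = pullbackForms ρ_r(f) d` on `Hᵈ(X, ℚ) =
rationalForms Φ d` (`Tr_ℂ = Tr_ℚ`: Layer A `trace_pullbackAlt_realRep_eq_ratCast_trace_pullbackForms`, both `= Σ` principal `d`-minors of `ρ_r(f)`).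
[cite: Fulton1998, §16.1 Example 16.1.15 (p0302 L36–L42)] [cite: FarmakisMoskowitz2013, §5.6 (PDF p. 135)] -/
theorem cast_integralHodgeClassesDeg_corrComp_graphClass_kunnethProjector_cup_diagonalClass_eq_ratCast_trace_pullbackForms {a d : ℕ} (had : 2 * g₁ = d + a) :
    ((integralHodgeClassesDeg (prodObj X X) e
        (integralHodgeClassesCup (prodObj X X).toIsog.Φ hgg
          (integralHodgeClassesPushforward g g₁ (liftHom (fstHom X (prodObj X X)) (sndHom X (prodObj X X) ≫ sndHom X X)) eT e h3 hgT h3' hg'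
            (integralHodgeClassesCup (prodObj X (prodObj X X)).toIsog.Φ hgg
              (integralHodgeClassesPullbackHom (liftHom (fstHom X (prodObj X X)) (sndHom X (prodObj X X) ≫ fstHom X X)) g₁
                (integralHodgeClassesPushforward 0 g₁ (graphHom f) eX e hX hg₁ hc hg' (unitIntegralHodgeClass X)))
              (integralHodgeClassesPullbackHom (sndHom X (prodObj X X)) g₁ (kunnethProjector X eX e hX hg₁ hc hg' a))))
          (integralHodgeClassesPushforward 0 g₁ (diagHom X) eX e hX hg₁ hc hg' (unitIntegralHodgeClass X))) : ℤ) : ℚ) =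
      (-1 : ℚ) ^ d * LinearMap.trace ℚ (rationalForms X.toIsog.Φ d) (pullbackForms X.toIsog.Φ X.toIsog.Φ f.1 d) := by
  have h := cast_integralHodgeClassesDeg_corrComp_graphClass_kunnethProjector_cup_diagonalClass_eq_trace X hgg eX e hX hg₁ hc hg' eT h3 hgT h3' f had
  rw [trace_pullbackAlt_realRep_eq_ratCast_trace_pullbackForms] at h
  exact_mod_cast h

/-! ### §2 `deg((π_a ∘ [Γ_f]) · [Δ_X]) = coeff_{tᵃ} P^r_f(t)` -/

/-- **THE KÜNNETH PROJECTORS READ THE CHARACTERISTIC POLYNOMIAL: `deg_{X×X}((π_a ∘ [Γ_f]) · [Δ_X]) = coeff_{tᵃ} P^r_f(t)`** in `ℤ`, for EVERY `a`, where `P^r_f(t) = det(t·1_Λ −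
ρ_r(f))` is the characteristic polynomial of the rational representation of the endomorphism `f` ("a monic polynomial in `t` of degree `2g`", `P^r_f(t) = Σ_ν (−1)^ν r_ν
t^{2g−ν}` with `r_ν = Tr(f^*|H^ν(X, ℚ))`, A1-33 `trace_pullbackForms_eq_charpoly_coeff`): by §1, `deg((π_a ∘ [Γ_f]) · [Δ]) = (−1)ᵈ r_d = coeff_{t^{2g−d}}` for `a + d = 2g`, and
both sides vanish for `a > 2g` (`π_a = 0`, g29-#5; `deg P^r_f = 2g`). [cite: Lange2023AbelianVarietiesComplex, §2.4.1 (p0114 L8–L12, L37)]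
[cite: Fulton1998, §16.1 Example 16.1.15 (p0302 L36–L42)] [cite: FarmakisMoskowitz2013, Lemma 3.5.17 (PDF p. 85)] -/
theorem integralHodgeClassesDeg_corrComp_graphClass_kunnethProjector_cup_diagonalClass_eq_charpoly_coeff (a : ℕ) :
    integralHodgeClassesDeg (prodObj X X) e
        (integralHodgeClassesCup (prodObj X X).toIsog.Φ hgg
          (integralHodgeClassesPushforward g g₁ (liftHom (fstHom X (prodObj X X)) (sndHom X (prodObj X X) ≫ sndHom X X)) eT e h3 hgT h3' hg'
            (integralHodgeClassesCup (prodObj X (prodObj X X)).toIsog.Φ hgg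
              (integralHodgeClassesPullbackHom (liftHom (fstHom X (prodObj X X)) (sndHom X (prodObj X X) ≫ fstHom X X)) g₁
                (integralHodgeClassesPushforward 0 g₁ (graphHom f) eX e hX hg₁ hc hg' (unitIntegralHodgeClass X)))
              (integralHodgeClassesPullbackHom (sndHom X (prodObj X X)) g₁ (kunnethProjector X eX e hX hg₁ hc hg' a))))
          (integralHodgeClassesPushforward 0 g₁ (diagHom X) eX e hX hg₁ hc hg' (unitIntegralHodgeClass X))) =
      f.1.charpoly.coeff a := by
  by_cases ha : 2 * g₁ < a
  · rw [kunnethProjector_eq_zero_of_lt X eX e hX hg₁ hc hg' ha, map_zero, map_zero, map_zero, map_zero, AddMonoidHom.zero_apply, map_zero,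
      Polynomial.coeff_eq_zero_of_natDegree_lt (by rw [Matrix.charpoly_natDegree_eq_dim, fintypeCard_eq_of_frame₉ X eX]; exact ha)]
  · have had : 2 * g₁ = (2 * g₁ - a) + a := by omega
    have h := cast_integralHodgeClassesDeg_corrComp_graphClass_kunnethProjector_cup_diagonalClass_eq_ratCast_trace_pullbackForms X hgg eX e hX hg₁ hc hg' eT h3 hgT h3' f had
    rw [trace_pullbackForms_eq_charpoly_coeff X.toIsog.Φ f.1 (by rw [fintypeCard_eq_of_frame₉ X eX]; omega), fintypeCard_eq_of_frame₉ X eX,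
      show 2 * g₁ - (2 * g₁ - a) = a by omega, ← mul_assoc, ← mul_pow, neg_mul_neg, one_mul, one_pow, one_mul] at h
    exact_mod_cast h

/-- **`deg_{X×X}((π_a ∘ [Γ_f]) · [Δ_X]) = (−1)ᵈ · Σ_{|I| = d} det ρ_r(f)_{I,I}`** (`a + d = 2g`): the signed sum of the principal `d × d` minors of the rational representation
(`= (−1)ᵈ tr ⋀ᵈρ_r(f)`, A1-33 `trace_pullbackForms_eq_sum_minors`; Farmakis–Moskowitz Lemma 3.5.17). [cite: FarmakisMoskowitz2013, Lemma 3.5.17 (PDF p. 85) and §5.6 (PDF p. 135)]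
[cite: Fulton1998, §16.1 Example 16.1.15 (p0302 L36–L42)] -/
theorem integralHodgeClassesDeg_corrComp_graphClass_kunnethProjector_cup_diagonalClass_eq_sum_minors {a d : ℕ} (had : 2 * g₁ = d + a) :
    integralHodgeClassesDeg (prodObj X X) e
        (integralHodgeClassesCup (prodObj X X).toIsog.Φ hgg
          (integralHodgeClassesPushforward g g₁ (liftHom (fstHom X (prodObj X X)) (sndHom X (prodObj X X) ≫ sndHom X X)) eT e h3 hgT h3' hg'
            (integralHodgeClassesCup (prodObj X (prodObj X X)).toIsog.Φ hgg
              (integralHodgeClassesPullbackHom (liftHom (fstHom X (prodObj X X)) (sndHom X (prodObj X X) ≫ fstHom X X)) g₁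
                (integralHodgeClassesPushforward 0 g₁ (graphHom f) eX e hX hg₁ hc hg' (unitIntegralHodgeClass X)))
              (integralHodgeClassesPullbackHom (sndHom X (prodObj X X)) g₁ (kunnethProjector X eX e hX hg₁ hc hg' a))))
          (integralHodgeClassesPushforward 0 g₁ (diagHom X) eX e hX hg₁ hc hg' (unitIntegralHodgeClass X))) =
      (-1) ^ d * ∑ s ∈ Finset.univ.powersetCard d, (f.1.submatrix (Subtype.val : s → X.toIsog.ι) (Subtype.val : s → X.toIsog.ι)).det := by
  have h := cast_integralHodgeClassesDeg_corrComp_graphClass_kunnethProjector_cup_diagonalClass_eq_ratCast_trace_pullbackForms X hgg eX e hX hg₁ hc hg' eT h3 hgT h3' f had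
  rw [trace_pullbackForms_eq_sum_minors] at h
  exact_mod_cast h

/-! ### §3 Summing over `a`: `deg([Γ_f] · [Δ_X]) = P^r_f(1) = det(1 − ρ_r(f))` -/

/-- **`Σ_{a=0}^{2g} deg((π_a ∘ [Γ_f]) · [Δ_X]) = deg([Γ_f] · [Δ_X])`** (`Σ_a π_a ∘ α = [Δ_X] ∘ α = α`, g29-#8 `sum_range_integralHodgeClassesCorrComp_kunnethProjector`, and bi-additivity of
the intersection product). [cite: Lange2023AbelianVarietiesComplex, §6.3.4 Prop. 6.3.11 (proof, p0319 L17–L19)] [cite: Fulton1998, §16.1 Example 16.1.15 (p0302 L36–L38)] -/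
theorem sum_range_integralHodgeClassesDeg_corrComp_graphClass_kunnethProjector_cup_diagonalClass :
    ∑ a ∈ Finset.range (2 * g₁ + 1), integralHodgeClassesDeg (prodObj X X) e
        (integralHodgeClassesCup (prodObj X X).toIsog.Φ hgg
          (integralHodgeClassesPushforward g g₁ (liftHom (fstHom X (prodObj X X)) (sndHom X (prodObj X X) ≫ sndHom X X)) eT e h3 hgT h3' hg'
            (integralHodgeClassesCup (prodObj X (prodObj X X)).toIsog.Φ hgg
              (integralHodgeClassesPullbackHom (liftHom (fstHom X (prodObj X X)) (sndHom X (prodObj X X) ≫ fstHom X X)) g₁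
                (integralHodgeClassesPushforward 0 g₁ (graphHom f) eX e hX hg₁ hc hg' (unitIntegralHodgeClass X)))
              (integralHodgeClassesPullbackHom (sndHom X (prodObj X X)) g₁ (kunnethProjector X eX e hX hg₁ hc hg' a))))
          (integralHodgeClassesPushforward 0 g₁ (diagHom X) eX e hX hg₁ hc hg' (unitIntegralHodgeClass X))) =
      integralHodgeClassesDeg (prodObj X X) e
        (integralHodgeClassesCup (prodObj X X).toIsog.Φ hgg (integralHodgeClassesPushforward 0 g₁ (graphHom f) eX e hX hg₁ hc hg' (unitIntegralHodgeClass X))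
          (integralHodgeClassesPushforward 0 g₁ (diagHom X) eX e hX hg₁ hc hg' (unitIntegralHodgeClass X))) := by
  rw [← map_sum, ← AddMonoidHom.finsetSum_apply, ← map_sum,
    sum_range_integralHodgeClassesCorrComp_kunnethProjector eX e hX hg₁ hc hg' eT e hgg h3 hgT h3' hg']

/-- **`Σ_{a=0}^{2g} coeff_{tᵃ} P^r_f = P^r_f(1) = det(1_Λ − ρ_r(f)) = deg([Γ_f] · [Δ_X])`**: summing §2 over `a` recovers the Lefschetz fixed-point formula `∫_{X×X} Γ_f · Δ = Σ (−1)ⁱ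
trace(f^*|Hⁱ X) = det(1 − ρ_r(f))` (Lange Prop. 2.4.3 (b) `P^r_f(n) = deg(n_X − f)` at `n = 1`; g28 `integralHodgeClassesDeg_diagonalClass_cup_graphClass_eq_det`, re-proved through
the Künneth projectors and without a linear order on the lattice basis). [cite: Fulton1998, §16.1 Example 16.1.15 (p0302 L36–L42)] [cite: Lange2023AbelianVarietiesComplex, §2.4.1 Prop. 2.4.3 (b) (p0114 L27–L33)] -/
theorem integralHodgeClassesDeg_graphClass_cup_diagonalClass_eq_det_one_sub :
    integralHodgeClassesDeg (prodObj X X) e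
        (integralHodgeClassesCup (prodObj X X).toIsog.Φ hgg (integralHodgeClassesPushforward 0 g₁ (graphHom f) eX e hX hg₁ hc hg' (unitIntegralHodgeClass X))
          (integralHodgeClassesPushforward 0 g₁ (diagHom X) eX e hX hg₁ hc hg' (unitIntegralHodgeClass X))) =
      (1 - f.1).det := by
  -- the composites `π_a ∘ [Γ_f]` formed on `X × (X × X)` in the frame `sumEnum eX e`
  rw [← sum_range_integralHodgeClassesDeg_corrComp_graphClass_kunnethProjector_cup_diagonalClass X hgg eX e hX hg₁ hc hg' (sumEnum eX e) rfl
      (by omega : (g₁ + g) + (g₁ + g) = 2 * g₁ + 2 * g) hc f,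
    Finset.sum_congr rfl fun a _ ↦ integralHodgeClassesDeg_corrComp_graphClass_kunnethProjector_cup_diagonalClass_eq_charpoly_coeff X hgg eX e hX hg₁ hc hg'
      (sumEnum eX e) rfl (by omega : (g₁ + g) + (g₁ + g) = 2 * g₁ + 2 * g) hc f a]
  have hP : f.1.charpoly.eval 1 = ∑ a ∈ Finset.range (2 * g₁ + 1), f.1.charpoly.coeff a := by
    rw [Polynomial.eval_eq_sum_range' (by rw [Matrix.charpoly_natDegree_eq_dim, fintypeCard_eq_of_frame₉ X eX]; exact Nat.lt_succ_self _) 1]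
    exact Finset.sum_congr rfl fun a _ ↦ by rw [one_pow, mul_one]
  rw [← hP, Matrix.eval_charpoly, map_one]

/-! ### §4 The case `f = n_X`: `deg((π_a ∘ [Γ_{n_X}]) · [Δ_X]) = nᵈ · (−1)ᵈ C(2g, d)` -/

variable {gT' : ℕ} (hT : g₁ + g = gT') (eT' : Fin (2 * gT') ≃ (prodObj X (prodObj X X)).toIsog.ι) (hgT' : gT' + gT' = 2 * gT') (hr : 2 * g₁ + 2 * g = 2 * gT')

include hT in
/-- **`deg_{X×X}((π_a ∘ [Γ_{n_X}]) · [Δ_X]) = nᵈ · (−1)ᵈ · C(2g, d)`** for `a + d = 2g` — the coefficient of `tᵃ` in `P^r_{n_X}(t) = (t − n)^{2g}`: `π_a ∘ Γ_{n_X} = n^{2g−a} π_a` ((6.19)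
transposed, g29-#10 `integralHodgeClassesCorrComp_graphClass_intMul_kunnethProjector`) and `deg(π_a · [Δ_X]) = (−1)ᵈ C(2g, d) = (−1)ᵈ b_d(X)` (g29-#12). [cite: Lange2023AbelianVarietiesComplex, §6.3.4 (6.19) (p0318 L19–L21) and §2.4.1 (p0114 L37)]
[cite: Fulton1998, §16.1 Example 16.1.15 (p0302 L36–L42)] -/
theorem integralHodgeClassesDeg_corrComp_graphClass_intMul_kunnethProjector_cup_diagonalClass (n : ℤ) {a d : ℕ} (had : 2 * g₁ = d + a) :
    integralHodgeClassesDeg (prodObj X X) e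
        (integralHodgeClassesCup (prodObj X X).toIsog.Φ hgg
          (integralHodgeClassesPushforward g g₁ (liftHom (fstHom X (prodObj X X)) (sndHom X (prodObj X X) ≫ sndHom X X)) eT' e hr hgT' hc hg'
            (integralHodgeClassesCup (prodObj X (prodObj X X)).toIsog.Φ hgg
              (integralHodgeClassesPullbackHom (liftHom (fstHom X (prodObj X X)) (sndHom X (prodObj X X) ≫ fstHom X X)) g₁
                (integralHodgeClassesPushforward 0 g₁ (graphHom (intMul X n)) eX e hX hg₁ hc hg' (unitIntegralHodgeClass X)))
              (integralHodgeClassesPullbackHom (sndHom X (prodObj X X)) g₁ (kunnethProjector X eX e hX hg₁ hc hg' a))))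
          (integralHodgeClassesPushforward 0 g₁ (diagHom X) eX e hX hg₁ hc hg' (unitIntegralHodgeClass X))) =
      n ^ d * ((-1) ^ d * ((2 * g₁).choose d : ℤ)) := by
  rw [integralHodgeClassesCorrComp_graphClass_intMul_kunnethProjector X hgg eX e hX hg₁ hc hg' hT eT' hgT' hr n (by omega : a ≤ 2 * g₁), integralHodgeClassesCup_zsmul_left,
    map_zsmul, integralHodgeClassesDeg_kunnethProjector_cup_diagonalClass X hgg eX e hX hg₁ hc hg' had, show 2 * g₁ - a = d by omega, smul_eq_mul]

end Graph

end ComplexTorusCat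

end Literature.AlgebraicGeometry.HodgeTheory
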